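import Mathlib.RingTheory.Localization.AtPrime.Basic
import Mathlib.RingTheory.Localization.Away.Basic
import Mathlib.RingTheory.Localization.Ideal
import Mathlib.RingTheory.Localization.Submodule
import Mathlib.RingTheory.Noetherian.Basic
import Mathlib.RingTheory.Ideal.Operations
import Mathlib.RingTheory.Finiteness.Ideal
import HarnessLib

/-!
# Crux `FrobeniusLadder.FRationalResolution` (stmt-ResolutionOfSingularities-15317), line `redirect`,
# stub `stub_diagonalizableQuotientResolution` — a centre cosupported on a stratum that localizes to a closed point is
# primary to that point on a basic open neighbourhood (brick T1 → E-k glue)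

Generic commutative algebra joining `…PrimaryMonomialCentre` (T1, scheme half: every prime over the monomial centre
`J = (φ(s))` contains the Kato ideal `I = (φ(P ∖ 0))`) with `…FixedPointKatoIdeal` (at a `D(A)`-fixed point `𝔮` the
Kato ideal localizes to the maximal ideal: every `r ∈ 𝔮` has `u r ∈ I` for some `u ∉ 𝔮`) and the receptacle
`…EtaleChartPrimaryCentre` (which wants `𝔮ⁿ ⊆ J ⊆ 𝔮` on an affine neighbourhood):

* `exists_away_pow_map_le` — **for `A` Noetherian, `𝔮` maximal, ideals `J` and `I` with `V(J) ⊆ V(I)` and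
  `I A_𝔮 ⊇ 𝔮 A_𝔮` (elementwise), there is `g ∉ 𝔮` such that `(𝔮 B)ⁿ ⊆ J B` for some `n`, for EVERY localization `B`
  of `A` away from `g`** (so also on every smaller basic open).

Honest label: plumbing (no stub closed). No definitions, no named facts, no sorry. [folklore; cite: AtiyahMacdonald1969, Prop. 3.11, Prop. 7.14]
-/

-- single-problem summit: the doubled namespace component is forced
set_option linter.dupNamespace false

namespace Summit.ResolutionOfSingularities.ResolutionOfSingularities.Theorems.FRationalResolution.PrimaryNearPoint

universe u

/-- **A centre cosupported on `V(I)` is `𝔮`-primary near `𝔮` when `I_𝔮 ⊇ 𝔮_𝔮`.** Let `A` be Noetherian, `𝔮` maximal,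
`I, J` ideals with `V(J) ⊆ V(I)` (every prime over `J` lies over `I`) and such that every `r ∈ 𝔮` has `u · r ∈ I` for
some `u ∉ 𝔮`. Then for some `g ∉ 𝔮` and every localization `B` of `A` away from `g`: `(𝔮 B)ⁿ ⊆ J B` for some `n`
(invert the finitely many `u`'s attached to generators of `𝔮`; then every prime of `B` over `J B` lies over `𝔮 B`, and
`B` is Noetherian). [cite: AtiyahMacdonald1969, Prop. 3.11, Prop. 7.14] -/
theorem exists_away_pow_map_le {A : Type u} [CommRing A] [IsNoetherianRing A] (𝔮 : Ideal A) [h𝔮 : 𝔮.IsMaximal]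
    (I J : Ideal A) (hcos : ∀ (𝔓 : Ideal A) [𝔓.IsPrime], J ≤ 𝔓 → I ≤ 𝔓)
    (hI : ∀ r ∈ 𝔮, ∃ u ∉ 𝔮, u * r ∈ I) :
    ∃ g ∉ 𝔮, ∀ (B : Type u) [CommRing B] [Algebra A B] [IsLocalization.Away g B],
      ∃ n : ℕ, (𝔮.map (algebraMap A B)) ^ n ≤ J.map (algebraMap A B) := by
  classical
  obtain ⟨t, ht⟩ := (IsNoetherian.noetherian 𝔮 : 𝔮.FG)
  -- a unit multiplier for each generator
  have hu : ∀ r : ↥t, ∃ u ∉ 𝔮, u * (r : A) ∈ I := fun r =>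
    hI r (by rw [← ht]; exact Ideal.subset_span r.2)
  choose u hu𝔮 huI using hu
  set g : A := ∏ r : ↥t, u r with hgdef
  have hg𝔮 : g ∉ 𝔮 := by
    rw [hgdef]
    exact fun h => by
      obtain ⟨r, -, hr⟩ := (h𝔮.isPrime.prod_mem_iff (s := Finset.univ) (x := fun r : ↥t => u r)).mp h
      exact hu𝔮 r hr
  refine ⟨g, hg𝔮, fun B _ _ _ => ?_⟩
  haveI : IsNoetherianRing B := IsLocalization.isNoetherianRing (Submonoid.powers g) B inferInstance
  -- each `u r` is a unit of `B`
  have hunit : ∀ r : ↥t, IsUnit (algebraMap A B (u r)) := by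
    intro r
    have hdvd : u r ∣ g := by
      rw [hgdef]; exact Finset.dvd_prod_of_mem _ (Finset.mem_univ r)
    obtain ⟨c, hc⟩ := hdvd
    have hgu : IsUnit (algebraMap A B g) := IsLocalization.Away.algebraMap_isUnit g
    rw [hc, map_mul] at hgu
    exact isUnit_of_mul_isUnit_left hgu
  -- every prime of `B` over `J B` contains `𝔮 B`
  have hrad : 𝔮.map (algebraMap A B) ≤ (J.map (algebraMap A B)).radical := by
    rw [Ideal.radical_eq_sInf, le_sInf_iff]
    rintro 𝔓' ⟨hJ𝔓', h𝔓'⟩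
    haveI := h𝔓'
    have hJ𝔓 : J ≤ 𝔓'.comap (algebraMap A B) := by
      rw [← Ideal.map_le_iff_le_comap]; exact hJ𝔓'
    have hI𝔓 : I ≤ 𝔓'.comap (algebraMap A B) := hcos _ hJ𝔓
    rw [Ideal.map_le_iff_le_comap, ← ht, Ideal.span_le]
    intro r hr
    have h1 : algebraMap A B (u ⟨r, hr⟩) * algebraMap A B r ∈ 𝔓' := by
      rw [← map_mul]; exact hI𝔓 (huI ⟨r, hr⟩)
    rcases h𝔓'.mem_or_mem h1 with h | h
    · exact absurd h (fun hmem => h𝔓'.ne_top (Ideal.eq_top_of_isUnit_mem _ hmem (hunit ⟨r, hr⟩)))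
    · exact h
  exact Ideal.exists_pow_le_of_le_radical_of_fg hrad (IsNoetherian.noetherian _)

end Summit.ResolutionOfSingularities.ResolutionOfSingularities.Theorems.FRationalResolution.PrimaryNearPoint
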